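import Mathlib.RingTheory.DedekindDomain.Factorization
import Mathlib.RingTheory.DedekindDomain.AdicValuation
import Literature.AlgebraicGeometry.Motives.GoodReduction
import Literature.AlgebraicGeometry.Motives.IntegralProjectiveSpace
import Literature.AlgebraicGeometry.Motives.GenericFibre
import Literature.AlgebraicGeometry.Motives.SmoothSpread
import HarnessLib

/-!
# Good reduction outside a finite set of places — proof of the spreading-out theorem

This file discharges the named fact `Literature.AlgebraicGeometry.Motives.exists_finite_hasGoodReductionOutside`
(`Literature/AlgebraicGeometry/Motives/GoodReduction.lean`):

> a smooth projective (geometrically irreducible) variety `X` of dimension `n` over a number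
> field `K` has good reduction outside a finite set `S` of finite places, i.e. for every
> `v ∉ S` there is an integral model of `X` over `𝓞_{K,v}` which is smooth of relative
> dimension `n` and proper

(EGA IV₃ 8.10.5 and IV₄ 17.7.8; Stacks, Tags 01ZM, 0C0C, 081F — "spreading out"), as
`Literature.AlgebraicGeometry.Motives.exists_finite_hasGoodReductionOutside_holds`. We prove it more generally over any Dedekind
domain `A` with fraction field `K` (`Literature.AlgebraicGeometry.Motives.exists_finite_forall_exists_integralModel`), via the
projective closure rather than through the general theory of limits of schemes:

1. *Model.* Choose a closed immersion `X ↪ ℙᴺ_K`. Since `ℙᴺ_K = ℙᴺ_A ×_A K`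
   (`Literature.AlgebraicGeometry.Motives.IntegralProjectiveSpace`, Liu 2002 Prop. 3.1.9 for the
   flat algebra `A → K`), the scheme-theoretic image `𝒳 ⊆ ℙᴺ_A` of `X → ℙᴺ_K → ℙᴺ_A` is a
   closed subscheme of `ℙᴺ_A`, hence proper over `A` (Hartshorne II 4.9), and its generic fibre
   is `X`: `X = 𝒳 ×_A K` (`Literature.AlgebraicGeometry.Motives.GenericFibre`, the flat
   monomorphism case of Stacks 081I).
2. *Smooth locus.* `𝒳 → Spec A` is of finite presentation (`A` is noetherian) and its generic
   fibre `X → Spec K` is smooth of relative dimension `n`, so every point of the generic fibre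
   lies in the open locus `W ⊆ 𝒳` where `𝒳 → Spec A` is smooth of relative dimension `n`
   (`Literature.AlgebraicGeometry.Motives.SmoothSpread`, the pointwise form of Stacks 0C0C/0EY2).
3. *Finiteness.* `𝒳 → Spec A` is proper, hence closed, so the image `C` of `𝒳 ∖ W` is a closed
   subset of `Spec A` not containing the generic point, i.e. `C ⊆ V(I)` for an ideal `I ≠ 0`,
   which contains only finitely many nonzero primes (`Ideal.finite_factors`).
4. *Local models.* For a nonzero prime `v` with `v ∉ C`, the points of `Spec A_v → Spec A` are the
   generic point and `v`, both outside `C`; so `𝒳 ×_A A_v → 𝒳` lands in `W` and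
   `𝒳 ×_A A_v → Spec A_v` is smooth of relative dimension `n` (base change of `W → Spec A`) and
   proper (base change), with generic fibre `(𝒳 ×_A A_v) ×_{A_v} K = 𝒳 ×_A K = X`. Here
   `A_v = valuationSubringAtPrime K v ⊆ K` (Mathlib), as in `Literature.AlgebraicGeometry.Motives.HasGoodReductionAt`.

## Main results

* `Literature.AlgebraicGeometry.Motives.HeightOneSpectrum.finite_setOf_mem_of_isClosed`: a closed subset of `Spec A` (`A`
  Dedekind) missing the generic point contains finitely many nonzero primes;
  `Literature.AlgebraicGeometry.Motives.HeightOneSpectrum.specMap_apply_eq_or`: `Spec A_v → Spec A` hits only `η` and `v`.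
* `Literature.AlgebraicGeometry.Motives.exists_finite_forall_exists_integralModel`: the spreading-out theorem over a Dedekind
  domain.
* `Literature.AlgebraicGeometry.Motives.exists_finite_hasGoodReductionOutside_holds`: the discharge (`A = 𝓞_K`).

## References

* A. Grothendieck, EGA IV₃ §8.10.5 (properness spreads out), IV₄ 17.7.8 (smoothness spreads
  out); the projective-closure argument is the classical one (e.g. Serre–Tate 1968, §1, for
  abelian varieties).
* The Stacks project, Tags 01ZM, 0C0C, 0EY2, 081F (limits of schemes: descent of finite
  presentation, smoothness, relative dimension, properness), 081I, 01R8 (scheme-theoretic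
  image), 01WC (projective ⇒ proper). [StacksProject]
* Q. Liu, *Algebraic Geometry and Arithmetic Curves* (2002), Prop. 3.1.9, Ex. 3.1.10
  (`ℙᴺ` and base change); §10.1 (models of curves, for comparison). [Liu2002]
* J.-P. Serre, J. Tate, *Good reduction of abelian varieties*, Ann. of Math. 88 (1968), §1. [SerreTate1968]
-/
noncomputable section

open CategoryTheory AlgebraicGeometry Limits IsDedekindDomain

universe u

namespace Literature.AlgebraicGeometry.Motives

/-! ### Dedekind domains: closed subsets of `Spec A` missing the generic point are finite -/

section Dedekind

variable {A : Type u} [CommRing A] [IsDedekindDomain A]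

/-- In the spectrum of a Dedekind domain `A`, a closed subset not containing the generic point
contains only finitely many nonzero primes: it is `V(I)` for an ideal `I ≠ 0`, and a nonzero
ideal of a Dedekind domain has finitely many prime factors (Mathlib `Ideal.finite_factors`).
[folklore] -/
theorem HeightOneSpectrum.finite_setOf_mem_of_isClosed {C : Set (PrimeSpectrum A)}
    (hC : IsClosed C) (hη : (⟨⊥, Ideal.isPrime_bot⟩ : PrimeSpectrum A) ∉ C) :
    {v : HeightOneSpectrum A | (⟨v.asIdeal, v.isPrime⟩ : PrimeSpectrum A) ∈ C}.Finite := by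
  obtain ⟨I, rfl⟩ := (PrimeSpectrum.isClosed_iff_zeroLocus_ideal C).mp hC
  have hI : I ≠ ⊥ := by
    rintro rfl
    exact hη (by simp)
  refine (Ideal.finite_factors hI).subset fun v hv ↦ ?_
  simp only [Set.mem_setOf_eq, PrimeSpectrum.mem_zeroLocus, SetLike.coe_subset_coe] at hv
  exact Ideal.dvd_iff_le.mpr hv

variable (A) in
/-- The points of `Spec A_𝔭 → Spec A` (localization of a Dedekind domain at a nonzero prime
`𝔭 = v`) map to the generic point or to `v`. [folklore] -/
theorem HeightOneSpectrum.specMap_apply_eq_or {L : Type u} [CommRing L] [Algebra A L]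
    (v : HeightOneSpectrum A) [IsLocalization.AtPrime L v.asIdeal] (p : Spec (.of L)) :
    Spec.map (CommRingCat.ofHom (algebraMap A L)) p = (⟨⊥, Ideal.isPrime_bot⟩ : PrimeSpectrum A) ∨
      Spec.map (CommRingCat.ofHom (algebraMap A L)) p = ⟨v.asIdeal, v.isPrime⟩ := by
  rw [Spec.map_apply]
  set q : PrimeSpectrum A := PrimeSpectrum.comap (CommRingCat.ofHom (algebraMap A L)).hom p
  have hle : q.asIdeal ≤ v.asIdeal := by
    intro x hx
    by_contra hxv
    have hu : IsUnit (algebraMap A L x) := IsLocalization.map_units L (⟨x, hxv⟩ : v.asIdeal.primeCompl)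
    exact p.2.ne_top (Ideal.eq_top_of_isUnit_mem _ hx hu)
  by_cases hq : q.asIdeal = ⊥
  · exact Or.inl (PrimeSpectrum.ext hq)
  · right
    have hmax : q.asIdeal.IsMaximal := q.2.isMaximal hq
    exact PrimeSpectrum.ext (hmax.eq_of_le v.isPrime.ne_top hle)

end Dedekind

/-! ### The spreading-out theorem over a Dedekind domain -/

section Model

open IsDedekindDomain.HeightOneSpectrum

attribute [local instance] MvPolynomial.gradedAlgebra Literature.AlgebraicGeometry.Motives.ProjBaseChange.algebraBase

variable {A K : Type u} [CommRing A] [IsDedekindDomain A] [Field K] [Algebra A K]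
  [IsFractionRing A K] {n : ℕ} {X : SchemeOver K}

/-- **Spreading out a smooth projective variety over a Dedekind domain.** Let `A` be a Dedekind
domain with fraction field `K` and `X` a smooth projective variety of dimension `n` over `K`.
Then for all but finitely many nonzero primes `v` of `A`, `X` has an integral model over the
local ring `A_v ⊆ K` which is smooth of relative dimension `n` and proper. Proof: let
`𝒳 ⊆ ℙᴺ_A` be the scheme-theoretic closure of `X ⊆ ℙᴺ_K = ℙᴺ_A ×_A K`; it is proper over `A`
with generic fibre `X` (`isPullback_toImage_of_flat_mono`); the locus where `𝒳 → Spec A` is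
smooth of relative dimension `n` is open and contains the generic fibre
(`exists_smoothOfRelativeDimension_ι_comp_of_isPullback`), so by properness its complement maps onto a closed subset of
`Spec A` missing the generic point, i.e. onto finitely many closed points; for the other `v`,
`𝒳 ×_A A_v` lies over the good locus, hence is smooth of relative dimension `n`, and it is
proper, with generic fibre `X` (EGA IV₃ 8.10.5, IV₄ 17.7.8; Stacks, Tags 01ZM, 0C0C, 081F, in the
projective case). [cite: StacksProject, Tags 01ZM, 0C0C and 081F (spreading out; here via the projective closure)] -/
theorem exists_finite_forall_exists_integralModel (hX : IsSmoothProjective n X) :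
    ∃ S : Set (HeightOneSpectrum A), S.Finite ∧ ∀ v ∉ S,
      ∃ 𝒳 : IntegralModel (valuationSubringAtPrime K v) K X, 𝒳.IsSmoothProper n := by
  classical
  haveI : Module.Flat A K := IsLocalization.flat K (nonZeroDivisors A)
  obtain ⟨N, ι, hι⟩ := hX.isProjectiveOver
  -- (the target of `ι.left` is `ℙᴺ_K = Proj K[x₀,…,x_N]`; we restate the instance with the
  -- unfolded target so that instance resolution finds it)
  haveI : @IsClosedImmersion X.left (Proj (MvPolynomial.homogeneousSubmodule (Fin (N + 1)) K))
      ι.left := hι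
  haveI := hX.smoothOfRelativeDimension
  -- the base change `Spec K → Spec A`
  set i : Spec (.of K) ⟶ Spec (.of A) := Spec.map (CommRingCat.ofHom (algebraMap A K)) with hi
  haveI : Flat i := Motives.flat_specMap_of_isLocalization A K (nonZeroDivisors A)
  haveI : Mono i := Motives.mono_specMap_of_isLocalization A K (nonZeroDivisors A)
  haveI : SurjectiveOnStalks i := SurjectiveOnStalks.Spec_iff.mpr
    (RingHom.surjectiveOnStalks_of_isLocalization (M := nonZeroDivisors A) K)
  -- projective spaces
  set pA := ProjBaseChangeRing.projToSpec (Fin (N + 1)) A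
  set pK := ProjBaseChangeRing.projToSpec (Fin (N + 1)) K
  set φ := Proj.map (ProjBaseChangeRing.mapGraded A K (Fin (N + 1)))
    (ProjBaseChangeRing.irrelevant_le_map A K (Fin (N + 1)))
  have hP : IsPullback φ pK pA i := ProjBaseChangeRing.isPullback_projMap A K (Fin (N + 1))
  haveI : QuasiCompact φ := MorphismProperty.of_isPullback hP.flip inferInstance
  have hιw : ι.left ≫ pK = X.hom := Over.w ι
  -- the model over `A`: the scheme-theoretic image of `X → ℙᴺ_K → ℙᴺ_A`
  set g := ι.left ≫ φ
  set f : g.image ⟶ Spec (.of A) := g.imageι ≫ pA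
  have Hgen : IsPullback g.toImage X.hom f i :=
    Motives.isPullback_toImage_of_flat_mono i pA pK φ hP _ X.hom hιw
  haveI : IsProper pA := ProjBaseChangeRing.isProper_projToSpec (Fin (N + 1)) A
  haveI : IsProper f := inferInstance
  haveI : LocallyOfFinitePresentation f := inferInstance
  -- the good locus `W` (where `f` is smooth of relative dimension `n`) contains the generic fibre
  set η : Spec (.of A) := ⟨⊥, Ideal.isPrime_bot⟩
  set pt : Spec (.of K) := ⟨⊥, Ideal.isPrime_bot⟩
  have hipt : i pt = η := by
    rw [hi, Spec.map_apply]
    exact PrimeSpectrum.ext (Ideal.comap_bot_of_injective _ (IsFractionRing.injective A K))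
  set W : g.image.Opens := sSup {V | SmoothOfRelativeDimension n (V.ι ≫ f)}
  have hWs : SmoothOfRelativeDimension n (W.ι ≫ f) :=
    Motives.smoothOfRelativeDimension_sSup_ι_comp n f _ fun V hV ↦ hV
  have hgen : ∀ x : g.image, f x = η → x ∈ W := fun x hx ↦ by
    obtain ⟨V, hV, hxV⟩ := Motives.exists_smoothOfRelativeDimension_ι_comp_of_isPullback n Hgen
      x pt (hx.trans hipt.symm)
    exact (le_sSup hV : V ≤ W) hxV
  -- the bad set: the image of the complement of `W`, a closed set missing the generic point
  set C : Set (Spec (.of A)) := ⇑f '' (W : Set g.image)ᶜ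
  have hCc : IsClosed C := f.isClosedMap _ W.isOpen.isClosed_compl
  have hηC : η ∉ C := by
    rintro ⟨x, hx, hxη⟩
    exact hx (hgen x hxη)
  refine ⟨{v | (⟨v.asIdeal, v.isPrime⟩ : PrimeSpectrum A) ∈ C},
    HeightOneSpectrum.finite_setOf_mem_of_isClosed hCc hηC, fun v hv ↦ ?_⟩
  -- the model at a good prime `v`: base change to `A_v = valuationSubringAtPrime K v`
  set Ov := valuationSubringAtPrime K v
  set t : Spec (.of Ov) ⟶ Spec (.of A) := Spec.map (CommRingCat.ofHom (algebraMap A Ov))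
  let M : SchemeOver A := Over.mk f
  let Mv : SchemeOver (Ov : Type u) := (baseChange A (Ov : Type u)).obj M
  have HMv : IsPullback (pullback.fst f t) Mv.hom f t := IsPullback.of_hasPullback f t
  have hrange : Set.range ⇑(pullback.fst f t) ⊆ (W : Set g.image) := by
    rintro _ ⟨z, rfl⟩
    by_contra hz
    have hmem : f (pullback.fst f t z) ∈ C := ⟨_, hz, rfl⟩
    have hft : f (pullback.fst f t z) = t (pullback.snd f t z) := by
      rw [← Scheme.Hom.comp_apply, pullback.condition, Scheme.Hom.comp_apply]
    rw [hft] at hmem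
    rcases HeightOneSpectrum.specMap_apply_eq_or A v (pullback.snd f t z) with h | h
    · rw [h] at hmem
      exact hηC hmem
    · rw [h] at hmem
      exact hv hmem
  have hsmooth : SmoothOfRelativeDimension n Mv.hom :=
    Motives.smoothOfRelativeDimension_of_range_subset hWs HMv hrange
  have hproper : IsProper Mv.hom := MorphismProperty.baseChange_obj _ _ ‹IsProper f›
  -- the generic fibre: `(𝒳 ×_A A_v) ×_{A_v} K ≅ 𝒳 ×_A K ≅ X` (pullback pasting, Mathlib
  -- `Over.pullbackComp`, and the cartesian square `Hgen`)
  have hcomp : (algebraMap (Ov : Type u) K).comp (algebraMap A Ov) = algebraMap A K :=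
    (IsScalarTower.algebraMap_eq A Ov K).symm
  let eComp : baseChange A (Ov : Type u) ⋙ baseChange (Ov : Type u) K ≅ baseChange A K :=
    (Over.pullbackComp (Spec.map (CommRingCat.ofHom (algebraMap (Ov : Type u) K)))
      (Spec.map (CommRingCat.ofHom (algebraMap A Ov)))).symm ≪≫ eqToIso (by
        change Over.pullback _ = Over.pullback _
        congr 1
        rw [← Spec.map_comp, ← CommRingCat.ofHom_comp, hcomp])
  let eK : (baseChange A K).obj M ≅ X :=
    (Over.isoMk Hgen.isoPullback Hgen.isoPullback_hom_snd :
      X ≅ Over.mk (pullback.snd f i)).symm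
  let e : (baseChange (Ov : Type u) K).obj Mv ≅ X := eComp.app M ≪≫ eK
  exact ⟨⟨Mv, e⟩, hsmooth, hproper⟩

end Model

/-! ### Discharge of the named fact -/

section NumberField

open scoped NumberField

variable {K : Type} [Field K] [NumberField K] {X : SchemeOver K} {n : ℕ}

/-- **Discharge of `Literature.AlgebraicGeometry.Motives.exists_finite_hasGoodReductionOutside`** (spreading out): a smooth
projective variety over a number field `K` has good reduction outside a finite set of finite
places, i.e. admits a smooth proper model over `𝓞_{K,v}` for all `v` outside a finite set.
This is `exists_finite_forall_exists_integralModel` for the Dedekind domain `𝓞_K`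
(EGA IV₃ 8.10.5, IV₄ 17.7.8; Stacks, Tags 01ZM, 0C0C, 081F).
[cite: StacksProject, Tags 01ZM, 0C0C and 081F (spreading out / limits of schemes)] -/
theorem exists_finite_hasGoodReductionOutside_holds :
    exists_finite_hasGoodReductionOutside (X := X) (n := n) := fun hX ↦ by
  obtain ⟨S, hS, h⟩ := exists_finite_forall_exists_integralModel (A := 𝓞 K) hX
  exact ⟨S, hS, fun v hv ↦ h v hv⟩

end NumberField

end Literature.AlgebraicGeometry.Motives

end
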